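import Summits.BirchSwinnertonDyer.BirchSwinnertonDyer.Theorems.ByReductionTypeAtTwoOrdKatoHalfAtTwoIsoGreenbergMuDefs
import Summits.BirchSwinnertonDyer.BirchSwinnertonDyer.Theorems.ByReductionTypeAtTwoOrdKatoHalfAtTwoIsoGreenbergMuNegDefs
import Literature.NumberTheory.EllipticCurves.IwasawaSelmerIsTorsionProofs
import Literature.NumberTheory.EllipticCurves.KatoRankBoundProofs
import HarnessLib

/-!
# Cert53a — crux-triage r1-2 GEN 53 (independent seat 2/2), crux `ByReductionTypeAtTwo.OrdKatoHalfAtTwoIso`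
# (item stmt-BirchSwinnertonDyer-19573), line `steinberg-fibre-at-two`, skeleton of record v24 `4921f2ec…`.

JUNK-IMMUNITY OF THE DATUM BINDER `∀ D : W.SelmerDualData κ γ` in the registered research stub G11⁺
(`stub_greenbergMu_two_posDisc : GreenbergMuZeroTwoOrdPosDisc`, p733065) and in the landed, unregistered G11⁻
(`GreenbergMuZeroTwoOrdNegDisc`, p735706), in the KERNEL and ROUTE-FILE-FREE.

Cheap-attack question (refuter step 6 (ii), «instantiate the interface at a junk model»): `SelmerDualData` is a STRUCTURE whose
carrier `X` is a field — could an exotic datum `D` (a strange `Λ`-module structure on some type) make `D.mu ≠ 0` and so REFUTE G11± for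
a reason that has nothing to do with Greenberg's Conjecture 1.11 at `2`?  NO: the structure pins `X` to `Hom(Sel_{2^∞}(W/ℚ_∞), ℚ/ℤ)`
(`toDual` bijective, `T` acts as `conj_γ − 1`, constants through `ℤ₂ → ℤ/2ᵏ`), the tree PROVES that these identities force the
`Λ`-module up to isomorphism (`SelmerDualData.nonempty_linearEquiv_holds`, file `IwasawaSelmerDualUniquenessProofs`) and hence
`SelmerDualData.mu_eq : D.mu = D'.mu` (file `IwasawaSelmerIsTorsionProofs`), and a genuine datum EXISTS for every normalised `(κ, γ)`
(`nonempty_selmerDualData_holds`).  Consequently, at fixed `(W, κ, γ)` the binder is INERT — `(∀ D, D.mu = 0) ↔ (∃ D, D.mu = 0)` —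
and G11⁺ / G11⁻ are each equivalent to their `∃ D` forms: neither junk-refutable nor junk-provable through the choice of `D`; any
`D` with `μ ≠ 0` would be a counterexample to Greenberg 1.11 at `2` itself (every datum then has `μ ≠ 0`).
Certifies equivalences between displayed statements only; asserts nothing; BSD is NOT proved; G11± and the crux are OPEN.
-/

set_option autoImplicit false
set_option linter.dupNamespace false

open Literature.NumberTheory.EllipticCurves Literature.NumberTheory.EllipticCurves.Rank1Residual
open Literature.NumberTheory.GaloisRepresentations WeierstrassCurve
open Summit.BirchSwinnertonDyer.BirchSwinnertonDyer.Theorems.SteinbergFibreAtTwo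

namespace Summit.BirchSwinnertonDyer.BirchSwinnertonDyer.Cruxes.OrdKatoHalfAtTwoIso.Cert53a

/-- One datum decides all: if some Selmer dual datum of `(W, κ, γ)` has `μ = n`, every datum has `μ = n`
(uniqueness of the Iwasawa module, `SelmerDualData.mu_eq`). [folklore] -/
theorem mu_eq_of_one {W : WeierstrassCurve ℚ} {κ : ZpExtension ℚ 2} {γ : Field.absoluteGaloisGroup ℚ}
    (D : W.SelmerDualData κ γ) {n : ℕ} (h : D.mu = n) (D' : W.SelmerDualData κ γ) : D'.mu = n :=
  (SelmerDualData.mu_eq D' D).trans h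

/-- At fixed `(W, κ, γ)` with `γ` a topological generator the datum binder is INERT: `∀ D` and `∃ D` agree
(existence `nonempty_selmerDualData_holds` + uniqueness `SelmerDualData.mu_eq`). [folklore] -/
theorem forall_mu_eq_zero_iff_exists (W : WeierstrassCurve ℚ) (κ : ZpExtension ℚ 2)
    (γ : Field.absoluteGaloisGroup ℚ) (hγ : κ.IsTopGenerator γ) :
    (∀ D : W.SelmerDualData κ γ, D.mu = 0) ↔ (∃ D : W.SelmerDualData κ γ, D.mu = 0) := by
  obtain ⟨D₀⟩ := W.nonempty_selmerDualData_holds κ γ hγ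
  exact ⟨fun h => ⟨D₀, h D₀⟩, fun ⟨D, hD⟩ D' => mu_eq_of_one D hD D'⟩

/-- A datum with `μ ≠ 0` poisons EVERY datum: a refutation of G11± through some `D` is a refutation of Greenberg's
Conjecture 1.11 at `2` at that curve, never an artefact of the carrier. [folklore] -/
theorem forall_mu_ne_zero_of_exists {W : WeierstrassCurve ℚ} {κ : ZpExtension ℚ 2} {γ : Field.absoluteGaloisGroup ℚ}
    (h : ∃ D : W.SelmerDualData κ γ, D.mu ≠ 0) (D' : W.SelmerDualData κ γ) : D'.mu ≠ 0 := by
  obtain ⟨D, hD⟩ := h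
  exact fun h' => hD (mu_eq_of_one D' h' D)

/-- **G11⁺ is equivalent to its `∃ D` form** (the registered stub is junk-immune in `D`). [folklore] -/
theorem g11pos_iff_exists : GreenbergMuZeroTwoOrdPosDisc ↔
    ∀ (W : WeierstrassCurve ℚ) [W.IsElliptic] [W.IsGloballyMinimal], ¬ W.HasCM → W.analyticRank = 0 →
      GoodOrd W 2 → W.HasSurjectiveModNGaloisRep 2 → 0 < W.Δ →
      ∀ (κ : ZpExtension ℚ 2) (γ : Field.absoluteGaloisGroup ℚ), κ.IsCyclotomic → κ.IsTopGenerator γ →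
        IsCyclotomicVariable 2 γ → ∃ D : W.SelmerDualData κ γ, D.mu = 0 := by
  refine ⟨fun h W _ _ hcm hr hgo h2 hΔ κ γ hκ hγ hγ' => ?_, fun h W _ _ hcm hr hgo h2 hΔ κ γ hκ hγ hγ' => ?_⟩
  · exact (forall_mu_eq_zero_iff_exists W κ γ hγ).1 (h W hcm hr hgo h2 hΔ κ γ hκ hγ hγ')
  · exact (forall_mu_eq_zero_iff_exists W κ γ hγ).2 (h W hcm hr hgo h2 hΔ κ γ hκ hγ hγ')

/-- **G11⁻ is equivalent to its `∃ D` form** (the landed Δ < 0 twin is junk-immune in `D`). [folklore] -/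
theorem g11neg_iff_exists : GreenbergMuZeroTwoOrdNegDisc ↔
    ∀ (W : WeierstrassCurve ℚ) [W.IsElliptic] [W.IsGloballyMinimal],
      GoodOrd W 2 → W.HasSurjectiveModNGaloisRep 2 → W.Δ < 0 →
      ∀ (κ : ZpExtension ℚ 2) (γ : Field.absoluteGaloisGroup ℚ), κ.IsCyclotomic → κ.IsTopGenerator γ →
        IsCyclotomicVariable 2 γ → ∃ D : W.SelmerDualData κ γ, D.mu = 0 := by
  refine ⟨fun h W _ _ hgo h2 hΔ κ γ hκ hγ hγ' => ?_, fun h W _ _ hgo h2 hΔ κ γ hκ hγ hγ' => ?_⟩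
  · exact (forall_mu_eq_zero_iff_exists W κ γ hγ).1 (h W hgo h2 hΔ κ γ hκ hγ hγ')
  · exact (forall_mu_eq_zero_iff_exists W κ γ hγ).2 (h W hgo h2 hΔ κ γ hκ hγ hγ')

/-- **Pointwise refutation shape.** G11⁺ FAILS iff there is a cell curve, a normalised `(κ, γ)` and SOME datum with `μ ≠ 0` —
and then every datum of that `(W, κ, γ)` has `μ ≠ 0` (`forall_mu_ne_zero_of_exists`): the only way to kill the stub is a genuine
`μ > 0` example à la Greenberg–Drinen, which `ρ̄₂` onto (`E[2]` irreducible) is conjectured to exclude. [folklore] -/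
theorem not_g11pos_iff : ¬ GreenbergMuZeroTwoOrdPosDisc ↔
    ∃ (W : WeierstrassCurve ℚ) (_ : W.IsElliptic) (_ : W.IsGloballyMinimal), ¬ W.HasCM ∧ W.analyticRank = 0 ∧
      GoodOrd W 2 ∧ W.HasSurjectiveModNGaloisRep 2 ∧ 0 < W.Δ ∧
      ∃ (κ : ZpExtension ℚ 2) (γ : Field.absoluteGaloisGroup ℚ), κ.IsCyclotomic ∧ κ.IsTopGenerator γ ∧
        IsCyclotomicVariable 2 γ ∧ ∃ D : W.SelmerDualData κ γ, D.mu ≠ 0 := by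
  constructor
  · intro h
    by_contra hne
    apply h
    intro W _ _ hcm hr hgo h2 hΔ κ γ hκ hγ hγ' D
    by_contra hD
    exact hne ⟨W, ‹_›, ‹_›, hcm, hr, hgo, h2, hΔ, κ, γ, hκ, hγ, hγ', D, hD⟩
  · rintro ⟨W, _, _, hcm, hr, hgo, h2, hΔ, κ, γ, hκ, hγ, hγ', D, hD⟩ h
    exact hD (h W hcm hr hgo h2 hΔ κ γ hκ hγ hγ' D)

end Summit.BirchSwinnertonDyer.BirchSwinnertonDyer.Cruxes.OrdKatoHalfAtTwoIso.Cert53a
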